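import Literature.Analysis.FluidPDE.EnergyUniqueness
import Literature.Analysis.FluidPDE.NSQuasipotential
import Literature.Analysis.FluidPDE.ClassicalSolutionGalilean
import HarnessLib

/-!
# Barrier: Navier–Stokes is not «soft» — a decaying classical solution that agrees with a constant
# flow at one time agrees with it ever after; the only compactly supported space-time «perturbations»
# of a constant state are pressure gauges

Catalogue entry (kind (c), method-level lemma; cell ns-claims, D-0090; technique row «geometric /
bordism / h-principle-style gluing: build new global smooth solutions by perturbing a known (constant)
solution inside a compact space-time region»), salvage seat ns-claims-salvage-p1. Everything below is
PROVED, with zero fact debt: it rests on the tree's DISCHARGED uniqueness theorem for decaying classical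
solutions `Literature.Analysis.FluidPDE.IsClassicalNSSolutionOn.unique` (Majda–Bertozzi §3.1.1, Cor. 3.1,
energy method) [cite: MajdaBertozziCUP2002, §3.1.1 Cor. 3.1 p. 88], the rest state
`isClassicalNSSolutionOn_zero` and Galilean invariance `IsClassicalNSSolutionOn.galileanBoost_const_Ico`
[cite: MajdaBertozziCUP2002, §1.2].

THE DEVICE. Treat the Navier–Stokes system as a submanifold of a jet space and produce «new global
smooth solutions» by gluing: a (constant) solution `s` outside a compact space-time disk `D`, some other
local solution inside a smaller disk, an «integral bordism» in between, then «regularise» the glued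
integral manifold to a global smooth SECTION `s̄ = s + ν` with `ν` supported in `D` (and vary `ν` to reach
«different initial conditions», hence Clay-type data). Whatever the intermediate geometry, the OUTPUT is a
classical solution that coincides with `s` before (and after) the support of `ν`.

WHY NO SUCH OUTPUT EXISTS (kernel). Forward uniqueness of decaying classical solutions is a theorem
(energy inequality + Grönwall): a solution from rest stays at rest —
`eq_zero_of_initial_eq_zero`; hence there is no decaying classical solution on `[0,T)` that vanishes at
`t = 0` and is non-zero somewhere later — `not_exists_switch_on` (no velocity perturbation of the rest
state with compact space-time support, however the construction is phrased); by Galilean invariance the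
same holds about any constant flow `V` — `eq_const_of_initial_eq_const`; and once the velocity is the
constant flow, the momentum equation forces `∇p(t,·) ≡ 0` — `gradient_pressure_eq_zero_of_velocity_const`
— so the pressure differs from a constant by a function of time alone: the «non-constant solutions obtained
by perturbation» are exactly the pressure GAUGES `(V, p₀ + c(t))` (cf. the skeleton's
`Literature.Claims.NS.Prastaro2015.theoremA1_literal_holds`, gauge `p₀ + sin t`), which carry no
information about the Cauchy problem. (Viscosity `ν ≥ 0`: Euler included; a negative diffusion sign is
reduced to this case by time reversal inside the compact support — not formalised here.)

Cell record: instance under adjudication = claim C29 `Prastaro2015` (arXiv:1503.07851 v4, Thm A1 p.32 with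
(A.6) p.33; Example 4.5 p.28; typed skeleton `Literature.Claims.NS.Prastaro2015`, p478120; predicted
locator `Step4_Regularisation` / `Step4_concrete`). This entry is the METHOD-level statement; it is
independent of, and does not pre-empt, the cell's verdict of record (posted on the MAP, not here).

WHAT THIS IS NOT: not a claim about NS regularity or blow-up; not a claim about any author beyond the typed
locator.
-/

noncomputable section

open Set Filter Topology
open scoped Laplacian

namespace Literature.Barriers.NavierStokesRegularity

namespace CompactPerturbationRigidity

open Literature.Analysis.FluidPDE

variable {E : Type*} [NormedAddCommGroup E] [InnerProductSpace ℝ E] [FiniteDimensional ℝ E]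

/-- **From rest, at rest**: a classical solution of the unforced Navier–Stokes (`ν ≥ 0`, Euler included)
system on `[0,T)` with uniformly rapidly decaying velocity and `u(0) = 0` is identically `0` on `[0,T)`
(uniqueness of decaying classical solutions against the rest state). [cite: MajdaBertozziCUP2002, §3.1.1 Cor. 3.1 p. 88] -/
theorem eq_zero_of_initial_eq_zero {ν T : ℝ} (hν : 0 ≤ ν) {u : ℝ → E → E} {p : ℝ → E → ℝ}
    (h : IsClassicalNSSolutionOn (Ico 0 T) ν 0 u p) (hd : HasUniformRapidDecayOn (Ico 0 T) u)
    (h0 : u 0 = 0) {t : ℝ} (ht : t ∈ Ico 0 T) : u t = 0 :=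
  h.unique hν (isClassicalNSSolutionOn_zero (Ico 0 T) ν) hd (hasUniformRapidDecayOn_zero _) h0 ht

/-- **No «switch-on» from rest**: there is no decaying classical solution on `[0,T)` that vanishes at
`t = 0` and is non-zero at some later space-time point — in particular no velocity perturbation of the
rest state with compact space-time support, whatever gluing produced it.
[cite: MajdaBertozziCUP2002, §3.1.1 Cor. 3.1 p. 88] -/
theorem not_exists_switch_on {ν T : ℝ} (hν : 0 ≤ ν) {u : ℝ → E → E} {p : ℝ → E → ℝ}
    (h : IsClassicalNSSolutionOn (Ico 0 T) ν 0 u p) (hd : HasUniformRapidDecayOn (Ico 0 T) u)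
    (h0 : u 0 = 0) : ¬ ∃ t ∈ Ico 0 T, ∃ x : E, u t x ≠ 0 := by
  rintro ⟨t, ht, x, hx⟩
  exact hx (by rw [eq_zero_of_initial_eq_zero hν h hd h0 ht]; rfl)

/-- **The same about any constant flow** (Galilean invariance): if `u(0) ≡ V` and the boosted
perturbation `(t, y) ↦ u(t, y + tV) − V` decays uniformly rapidly on `[0,T)`, then `u(t) ≡ V` on `[0,T)`.
[cite: MajdaBertozziCUP2002, §1.2 and §3.1.1 Cor. 3.1] -/
theorem eq_const_of_initial_eq_const {ν T : ℝ} (hν : 0 ≤ ν) {u : ℝ → E → E} {p : ℝ → E → ℝ}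
    (h : IsClassicalNSSolutionOn (Ico 0 T) ν 0 u p) (V : E)
    (hd : HasUniformRapidDecayOn (Ico 0 T) (fun t y => u t (y + t • V) - V))
    (h0 : ∀ y, u 0 y = V) {t : ℝ} (ht : t ∈ Ico 0 T) (x : E) : u t x = V := by
  have hb := h.galileanBoost_const_Ico V
  have h0' : (fun t y => u t (y + t • V) - V) 0 = (0 : ℝ → E → E) 0 := by
    funext y; simp [h0]
  have hz := hb.unique hν (isClassicalNSSolutionOn_zero (Ico 0 T) ν) hd
    (hasUniformRapidDecayOn_zero _) h0' ht
  have hx := congrFun hz (x - t • V)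
  simp only [sub_add_cancel, Pi.zero_apply, sub_eq_zero] at hx
  exact hx

/-- **The residual freedom is a pressure gauge**: if the velocity of an unforced classical solution IS
the constant flow `V` on the time set `S`, the momentum equation forces `∇p(t,·) ≡ 0`, i.e. `p(t,·)` is
constant in space for each `t ∈ S` — the «perturbed» solutions are `(V, p₀ + c(t))`.
[cite: MajdaBertozziCUP2002, §1.2] -/
theorem gradient_pressure_eq_zero_of_velocity_const {S : Set ℝ} {ν : ℝ} {u : ℝ → E → E}
    {p : ℝ → E → ℝ} (h : IsClassicalNSSolutionOn S ν 0 u p) (V : E) (hu : ∀ t ∈ S, ∀ x, u t x = V)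
    {t : ℝ} (ht : t ∈ S) (x : E) : gradient (p t) x = 0 := by
  have hm := h.momentum t ht x
  have hut : u t = fun _ => V := funext (hu t ht)
  have h1 : timeDerivWithin S u t x = 0 := by
    unfold timeDerivWithin
    have e : EqOn (fun s => u s x) (fun _ => V) S := fun s hs => hu s hs x
    rw [derivWithin_congr e (hu t ht x)]
    simp
  have h2 : convect (u t) (u t) x = 0 := by rw [hut]; simp [convect]
  have h3 : (Δ (u t)) x = 0 := by
    rw [hut]
    have : Δ (fun _ : E => V) = 0 := by
      funext y
      rw [InnerProductSpace.laplacian_eq_iteratedFDeriv_orthonormalBasis _ (stdOrthonormalBasis ℝ E)]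
      simp [iteratedFDeriv_const_of_ne (𝕜 := ℝ) two_ne_zero V]
    rw [this]; rfl
  rw [h1, h2, h3, smul_zero, zero_sub, add_zero] at hm
  have hm' := hm
  simp only [Pi.zero_apply, add_zero, zero_eq_neg] at hm'
  exact hm'

/-- Hence each pressure slice is a constant: `p(t,x) = p(t,0)`. [cite: MajdaBertozziCUP2002, §1.2] -/
theorem pressure_slice_const_of_velocity_const {S : Set ℝ} {ν : ℝ} {u : ℝ → E → E}
    {p : ℝ → E → ℝ} (h : IsClassicalNSSolutionOn S ν 0 u p) (V : E) (hu : ∀ t ∈ S, ∀ x, u t x = V)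
    {t : ℝ} (ht : t ∈ S) (x : E) : p t x = p t 0 := by
  haveI : CompleteSpace E := FiniteDimensional.complete ℝ E
  have hp1 : Differentiable ℝ (p t) :=
    ((h.smooth_pressure.contDiff_slice ht).differentiable (by simp))
  have hD : ∀ y, fderiv ℝ (p t) y = 0 := fun y => by
    have hg := gradient_pressure_eq_zero_of_velocity_const h V hu ht y
    have e : fderiv ℝ (p t) y = (InnerProductSpace.toDual ℝ E) (gradient (p t) y) := by simp [gradient]
    rw [e, hg, map_zero]
  exact is_const_of_fderiv_eq_zero hp1 hD x 0

end CompactPerturbationRigidity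

open CompactPerturbationRigidity Literature.Analysis.FluidPDE

/-- **Barrier (method-level lemma): no compactly supported space-time perturbations of a constant
Navier–Stokes state — forward uniqueness turns «glue a perturbation inside a compact region» into
«the perturbation is a pressure gauge».** On `ℝ³` (`EuclideanSpace ℝ (Fin 3)`), `ν ≥ 0`, unforced.

BARRIER (structured block, D-0021):
technique_class: geometric-pde-bordism integral-bordism-gluing h-principle-style-perturbation jet-space-cartan-distribution compactly-supported-spacetime-perturbation perturb-a-constant-solution soft-construction-of-global-solutions
blocks: arguments for NavierStokesRegularity that manufacture «new global smooth solutions defined on all of ℝ³» (and, by «varying the localized perturbation», Clay-type data) by gluing a known constant solution outside a compact space-time disk to another solution inside and regularising the glued object to a smooth section `s̄ = s + ν`, `supp ν` compact; instance under adjudication C29 `Prastaro2015` (arXiv:1503.07851 v4: Thm A1 p.32 + (A.6) p.33, Lemma A2 pp.32–33, Example 4.5 p.28 / footnote 26; skeleton `Literature.Claims.NS.Prastaro2015`, `Step3_LemmaA2`/`Step4_Regularisation`/`Step4_concrete`) [cite: Prastaro2015Maslov, Thm A1 p.32; (A.6) p.33; Example 4.5 p.28].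
because: decaying classical solutions of the unforced system are unique forward in time (energy inequality + Grönwall) [cite: MajdaBertozziCUP2002, §3.1.1 Cor. 3.1 p. 88] — tree `IsClassicalNSSolutionOn.unique`; kernel consequences here: `eq_zero_of_initial_eq_zero` (from rest, at rest), `not_exists_switch_on` (no solution vanishing at `t = 0` is non-zero later), `eq_const_of_initial_eq_const` (the same about any constant flow, by Galilean invariance [cite: MajdaBertozziCUP2002, §1.2], tree `galileanBoost_const_Ico`), `gradient_pressure_eq_zero_of_velocity_const` / `pressure_slice_const_of_velocity_const` (with constant velocity the momentum equation kills `∇p`: the only residual freedom is `p₀ + c(t)`, a gauge — the skeleton's own `theoremA1_literal_holds` witness).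
evasions_known: (a) non-decaying / non-unique classes: without decay the Cauchy problem is genuinely non-unique (parasitic `u = a(t)`, `p = −a′·x`; Tao's normalisation, tree `UnnormalisedPressureLoophole`) — but such solutions are not compact perturbations and carry no Clay content; (b) weak solutions: convex-integration / intermittent constructions DO produce compactly supported-in-time non-trivial weak solutions (Buckmaster–Vicol; tree `BuckmasterVicolNonuniqueness`) — below the classical/Leray–Hopf regularity where uniqueness holds, hence no smooth global solutions from them; (c) hyperbolic systems (finite speed of propagation) admit compactly supported classical perturbations — Navier–Stokes/Stokes/heat do not.
scope_caveats: (i) kernel statements assume uniform rapid decay of the (boosted) perturbation on `[0,T)` — automatic for a smooth perturbation with compact space-time support on a slab strictly inside the smoothness domain, which the instance (refuter lane) supplies; (ii) `ν ≥ 0` (Euler included); a negative printed diffusion sign is handled by time reversal inside the compact support (not formalised); (iii) says nothing about NS blow-up or regularity.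
status: established (proved here; corollaries of the tree's discharged uniqueness theorem)
[cite: MajdaBertozziCUP2002, §3.1.1 Cor. 3.1 p. 88; §1.2] -/
def CompactPerturbationRigidity : Prop :=
  ∀ (ν T : ℝ), 0 ≤ ν →
    ∀ (u : ℝ → EuclideanSpace ℝ (Fin 3) → EuclideanSpace ℝ (Fin 3)) (p : ℝ → EuclideanSpace ℝ (Fin 3) → ℝ),
      IsClassicalNSSolutionOn (Ico 0 T) ν 0 u p →
        (HasUniformRapidDecayOn (Ico 0 T) u → u 0 = 0 → ∀ t ∈ Ico 0 T, u t = 0) ∧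
        (∀ V : EuclideanSpace ℝ (Fin 3),
          HasUniformRapidDecayOn (Ico 0 T) (fun t y => u t (y + t • V) - V) → (∀ y, u 0 y = V) →
            (∀ t ∈ Ico 0 T, ∀ x, u t x = V) ∧ ∀ t ∈ Ico 0 T, ∀ x, p t x = p t 0)

/-- Discharge of the barrier statement. [cite: MajdaBertozziCUP2002, §3.1.1 Cor. 3.1 p. 88] -/
theorem compactPerturbationRigidity_holds : CompactPerturbationRigidity := by
  intro ν T hν u p h
  refine ⟨fun hd h0 t ht => eq_zero_of_initial_eq_zero hν h hd h0 ht, fun V hd h0 => ?_⟩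
  have hu : ∀ t ∈ Ico 0 T, ∀ x, u t x = V := fun t ht x => eq_const_of_initial_eq_const hν h V hd h0 ht x
  exact ⟨hu, fun t ht x => pressure_slice_const_of_velocity_const h V hu ht x⟩

end Literature.Barriers.NavierStokesRegularity

end

-- WHAT THIS IS NOT: not a claim about NS regularity or blow-up; not a claim about any author beyond the typed locator.
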